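import Literature.AnabelianGeometry.EtaleTheta.TemperedFrobenioidCnst
import HarnessLib

/-!
# [EtTh] Prop. 3.4 (ii) / Thm. 3.7 (iii): an OBSTRUCTION SCHEMA for the `D^cnst`-naturality bundle `Prop34Cnst₀` —
# an automorphism invisible on the unit functions but moving a constant function rules out EVERY constant-field functor

S. Mochizuki, *The étale theta function and its Frobenioid-theoretic manifestations*, Publ. RIMS **45** (2009)
[MochizukiEtTh2009], §3 Prop. 3.4 (ii) p.74 («`O_L^× ⥲ Ker(B₀(Y^log) → Φ₀^gp(Y^log))`, …, `L^× ⥲ F₀(Y^log)`»), Thm. 3.7 (iii)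
pp.79–80 («the natural action of `Aut_C(A)` on `O^×(A)` … factors through `Aut_{D^cnst}(A^cnst)` … faithful»: in print
`Aut(L/K)` acts faithfully on `O_L^×` because the units generate `L` ADDITIVELY, `1 + 𝔪_L ⊆ O_L^×`)
[cite: MochizukiEtTh2009, Prop 3.4 (ii) p.74] [cite: MochizukiEtTh2009, Thm 3.7 (iii) p.79].

PROOF-ONLY (theorems only, 0 definitions; abc-iut cell, layer L2; seat abc-iut-w5-d034 gen 7 — floor re-seat, by-name tool for
the live rows R936 «PROP34CNST₀ WITH NON-CONSTANT `D^cnst` AT THE ζ-TWISTED TOWER» (holder abc-iut-w6-d057, spec abc-iut-w5-d179)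
and the 2c theta-twist tower of abc-iut-L2-t3; consumed BY NAME, nothing restated: abc-iut-L2-t3's hypothesis structure
`DivisorMonoids.Prop34Cnst₀` (`TemperedFrobenioidCnst.lean`)).

WHAT.  Over ARBITRARY Def. 3.3 (iii) data `dm : DivisorMonoids D₀` (abstract `Φ₀`, `B₀`, `B₀ → Φ₀^gp`, `F₀`):
* `Prop34Cnst₀.B₀_map_eq_self_of_forall_unit` — a NECESSARY CONDITION satisfied by every datum admitting SOME constant-field
  functor `cnst : D₀ ⥤ D^cnst` with `Prop34Cnst₀`: an automorphism `g` of a connected covering `Y` that acts trivially on the unit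
  functions `Ker(B₀(Y) → Φ₀^gp(Y))` (= `O_L^×`) acts trivially on ALL constant functions `F₀(Y)` (= `L^×`).  Proof: the third clause
  (`Aut(L/K)` faithful on `O_L^×`) gives `cnst(g) = cnst(𝟙)`, then the first clause (the pull-back action on `F₀` factors through
  `D^cnst`) gives `g^* = 𝟙^*` on `F₀(Y)`;
* **`not_prop34Cnst₀_of_unitTrivial_aut`** — the contrapositive as an OBSTRUCTION SCHEMA: ONE automorphism `g : Y ≅ Y` with
  `g^* b = b` for every unit function `b` but `g^* b₀ ≠ b₀` for some constant `b₀ ∈ F₀(Y)` makes `Prop34Cnst₀ dm cnst` FALSE FOR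
  EVERY category `D^cnst` and EVERY functor `cnst` (not merely for constant functors, cf. abc-iut-L2-d2's
  `TateTowerKummerTwist.not_prop34Cnst₀_const`, p483973, which refutes the CONSTANT functors at the ζ-twisted Kummer tower);
* `forall_not_prop34Cnst₀_of_unitTrivial_aut` — the same with the universal quantifier over `(D^cnst, cnst)` displayed;
* `Prop34Cnst₀.B₀_map_eq_of_forall_unit` — design-check form: two automorphisms agreeing on the unit functions agree on `F₀(Y)`.
READING (design check, words not kernel): at a class-(b) tower model whose unit functions are the recorded roots of unity only,
the schema FIRES as soon as some group element fixes the roots of unity but moves a Kummer root of a CONSTANT (e.g. a root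
`ϖ^{1/N}` of the uniformiser): then `Prop34Cnst₀` — hence Thm. 3.7 (iii) AS TYPED over `Prop34Cnst₀` — is unsatisfiable there
for every `D^cnst`; where every element moving a constant already moves a root of unity, the schema is silent.
HONEST FRAMING: a statement about the typed INTERFACE `Prop34Cnst₀` (its third clause transcribes print's additive faithfulness
`Aut(L/K) ↪ Aut(O_L^×)` into a multiplicative datum); it takes no side on [IUTchIII] Cor. 3.12; nothing here asserts abc proved
or refuted; typed ≠ proved.
-/

namespace Literature.AnabelianGeometry.EtaleTheta

open CategoryTheory Opposite

universe u₀ v₀ u₁ v₁ w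

namespace DivisorMonoids

variable {D₀ : Type u₀} [Category.{v₀} D₀] (dm : DivisorMonoids.{u₀, v₀, w} D₀)

/-- The pull-back along the identity covering map is the identity on `B₀(Y)`.
[cite: MochizukiEtTh2009, Def 3.3 (iii) p.73] -/
theorem B₀_map_id_apply (Y : D₀) (b : dm.B₀.obj (op Y)) : (dm.B₀.map (𝟙 Y).op).hom b = b := by
  rw [op_id, dm.B₀.map_id]
  rfl

namespace Prop34Cnst₀

variable {dm} {Dc : Type u₁} [Category.{v₁} Dc] {cnst : D₀ ⥤ Dc}

/-- **Necessary condition carried by every `Prop34Cnst₀` datum** ([EtTh] Prop. 3.4 (ii) with the faithfulness step of Thm. 3.7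
(iii), p.80): if an automorphism `g` of `Y` pulls back every UNIT function (`div₀ b = 1`, i.e. `b ∈ O_L^×`) to itself, then it
pulls back every CONSTANT function `b ∈ F₀(Y) = L^×` to itself — clause three gives `cnst(g) = cnst(𝟙_Y)`, clause one then
equates the two pull-back actions on `F₀(Y)`. [cite: MochizukiEtTh2009, Thm 3.7 (iii) p.79] -/
theorem B₀_map_eq_self_of_forall_unit (h : dm.Prop34Cnst₀ cnst) {Y : D₀} (g : Y ≅ Y)
    (hunit : ∀ b : dm.B₀.obj (op Y), dm.div₀ (op Y) b = 1 → (dm.B₀.map g.hom.op).hom b = b)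
    (b : dm.B₀.obj (op Y)) (hb : b ∈ dm.F₀ (op Y)) : (dm.B₀.map g.hom.op).hom b = b := by
  have h3 : cnst.map g.hom = cnst.map (Iso.refl Y).hom :=
    h.cnst_map_eq_of_B₀_map_eq g (Iso.refl Y) fun b' hb' => by
      rw [hunit b' hb', Iso.refl_hom, dm.B₀_map_id_apply]
  have h1 := h.B₀_map_eq_of_cnst_map_eq g.hom (𝟙 Y) (by rw [h3, Iso.refl_hom]) b hb
  rw [h1, dm.B₀_map_id_apply]

/-- The same necessary condition read on the images in `D^cnst`: an automorphism acting trivially on the unit functions has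
the image of the identity, `cnst(g) = 𝟙_{Y^cnst}`. [cite: MochizukiEtTh2009, Thm 3.7 (iii) p.80] -/
theorem cnst_map_eq_id_of_forall_unit (h : dm.Prop34Cnst₀ cnst) {Y : D₀} (g : Y ≅ Y)
    (hunit : ∀ b : dm.B₀.obj (op Y), dm.div₀ (op Y) b = 1 → (dm.B₀.map g.hom.op).hom b = b) :
    cnst.map g.hom = 𝟙 (cnst.obj Y) := by
  rw [← cnst.map_id, ← Iso.refl_hom]
  exact h.cnst_map_eq_of_B₀_map_eq g (Iso.refl Y) fun b' hb' => by
    rw [hunit b' hb', Iso.refl_hom, dm.B₀_map_id_apply]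

/-- Design-check form: under `Prop34Cnst₀` the pull-back action of `Aut(Y)` on the constants `F₀(Y)` is DETECTED by its
action on the unit functions — two automorphisms agreeing on `Ker(B₀(Y) → Φ₀^gp(Y))` agree on `F₀(Y)`.
[cite: MochizukiEtTh2009, Thm 3.7 (iii) p.80] -/
theorem B₀_map_eq_of_forall_unit (h : dm.Prop34Cnst₀ cnst) {Y : D₀} (g g' : Y ≅ Y)
    (hunit : ∀ b : dm.B₀.obj (op Y), dm.div₀ (op Y) b = 1 →
      (dm.B₀.map g.hom.op).hom b = (dm.B₀.map g'.hom.op).hom b)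
    (b : dm.B₀.obj (op Y)) (hb : b ∈ dm.F₀ (op Y)) :
    (dm.B₀.map g.hom.op).hom b = (dm.B₀.map g'.hom.op).hom b :=
  h.B₀_map_eq_of_cnst_map_eq g.hom g'.hom (h.cnst_map_eq_of_B₀_map_eq g g' hunit) b hb

end Prop34Cnst₀

/-- **OBSTRUCTION SCHEMA for `Prop34Cnst₀`** ([EtTh] Prop. 3.4 (ii) / Thm. 3.7 (iii)): ONE automorphism `g : Y ≅ Y` of a
connected covering that is INVISIBLE on the unit functions (`g^* b = b` whenever `div₀ b = 1`) but MOVES some constant function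
`b₀ ∈ F₀(Y)` (`g^* b₀ ≠ b₀`) makes the `D^cnst`-naturality bundle `Prop34Cnst₀ dm cnst` FALSE — for the given, hence (the
hypotheses not mentioning `cnst`) for EVERY constant-field category and functor.  In print no such `g` exists (`Aut(L/K)` is
faithful on `O_L^× ∋ 1 + ϖ^{1/N}`); at a multiplicative design model recording only roots of unity as unit constants, a group
element fixing the roots of unity and moving a Kummer root of a constant is such a `g`. [cite: MochizukiEtTh2009, Thm 3.7 (iii) p.79] -/
theorem not_prop34Cnst₀_of_unitTrivial_aut {Y : D₀} (g : Y ≅ Y)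
    (hunit : ∀ b : dm.B₀.obj (op Y), dm.div₀ (op Y) b = 1 → (dm.B₀.map g.hom.op).hom b = b)
    {b₀ : dm.B₀.obj (op Y)} (hb₀ : b₀ ∈ dm.F₀ (op Y)) (hmove : (dm.B₀.map g.hom.op).hom b₀ ≠ b₀)
    {Dc : Type u₁} [Category.{v₁} Dc] (cnst : D₀ ⥤ Dc) : ¬ dm.Prop34Cnst₀ cnst :=
  fun h => hmove (h.B₀_map_eq_self_of_forall_unit g hunit b₀ hb₀)

/-- **No constant-field functor whatsoever** satisfies `Prop34Cnst₀` over a datum carrying a unit-trivial automorphism that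
moves a constant — the universal quantifier over `(D^cnst, cnst)` displayed (strictly stronger than refuting the CONSTANT
functors `(Functor.const _).obj X₀`). [cite: MochizukiEtTh2009, Thm 3.7 (iii) p.79] -/
theorem forall_not_prop34Cnst₀_of_unitTrivial_aut {Y : D₀} (g : Y ≅ Y)
    (hunit : ∀ b : dm.B₀.obj (op Y), dm.div₀ (op Y) b = 1 → (dm.B₀.map g.hom.op).hom b = b)
    {b₀ : dm.B₀.obj (op Y)} (hb₀ : b₀ ∈ dm.F₀ (op Y)) (hmove : (dm.B₀.map g.hom.op).hom b₀ ≠ b₀) :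
    ∀ (Dc : Type u₁) [Category.{v₁} Dc] (cnst : D₀ ⥤ Dc), ¬ dm.Prop34Cnst₀ cnst :=
  fun _ _ cnst => dm.not_prop34Cnst₀_of_unitTrivial_aut g hunit hb₀ hmove cnst

end DivisorMonoids

end Literature.AnabelianGeometry.EtaleTheta
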